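import Mathlib
import Summits.Langlands.Langlands.Theses.PicardMuOrdinary
import Literature.NumberTheory.GaloisRepresentations.CubicResidueSymbol
import Literature.NumberTheory.GaloisRepresentations.GaloisRep
import Literature.NumberTheory.GaloisRepresentations.IntegralGaloisActionProofs
import Literature.NumberTheory.Automorphic.ReciprocityGLnProofs
import Literature.NumberTheory.Automorphic.AsaiSign
import Literature.NumberTheory.Automorphic.GLnAdelicStructureProofs
import Literature.AlgebraicGeometry.Motives.PicardCurveMuOrdinaryReduction

/-!
# drefute g3 probes for line `split-ramified-prime-sqrt6` (crux stmt-Langlands-13758)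

Kernel-checked facts for the lead's reshape (refuter `refuter-drefute-stmt-Langlands-13758-g3-0`):

* `composition_of_any_split` — the skeleton's composition is PREDICATE-AGNOSTIC: for ANY
  `Q : ℤ[X] → Prop` in place of the (empty) `HasMuOrdinaryReductionAtThree`, Stubs 1, 2, 4, 6
  verbatim + Stub 3/5 guarded by `Q f` + Stub 7 guarded by `¬ Q f` imply the crux.  So the
  planner's predicate swap (Jacobian-level type (b)) touches only the guard.
* `composition_of_galois_split` — the same with a GALOIS-SIDE guard
  `Q f ι e ρ` (a predicate on Stub 2's output `ρ`, e.g. "`ρ|_{G_{K_λ}}` potentially ordinary for the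
  Borel of `Res_{K_λ/ℚ₃} GL₃`"), case split AFTER Stubs 1–2; the remainder stub then has
  `ι, e, S₀, ϖ, ρ`, the adaptedness of `ι` and the trace identity IN HAND (a strictly more
  informative remainder than Stub 7 as typed).
* `remainder_iff_crux_of_empty` — for any guard `Q` that is empty on admissible `f`, the
  `f`-level remainder stub is literally equivalent to the crux (the costume, for general `Q`).
* `frobTrace_hypothesis_nonvacuous` / `frobTrace_hypothesis_pins` — the Frobenius-trace hypothesis
  shape of Stubs 2/4/5/6 (`∀ 𝔓 ∈ 𝔭.primesAbove, ∀ τ, IsArithFrobAt τ 𝔓 → tr ρ τ⁻¹ = x`) is NOT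
  decoration: it pins `x` (tree facts `primesAbove_nonempty`,
  `exists_isArithFrobAt_of_mem_primesAbove_holds`).  In particular Stub 4's free function `a` is
  determined by `ρ` off `S₀`.
* `hcptL_dischargeable` — the `∃ hcptL : isCompact_glFiniteIntegralLevel 3 L` conjunct of Stub 4's
  conclusion is no obstruction (`isCompact_glFiniteIntegralLevel_holds`).
* §(6) reshape r2 (lead 04:31Z, guard removed): `composition_r2` (= instance `Q := ⊤`),
  `stub5U_of_resplit` / `composition_r2_resplit` (engine branch `Stub5G Q` + remainder `Stub5RemG Q`).
-/

open Literature.NumberTheory.GaloisRepresentations Literature.NumberTheory.Automorphic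
open IsDedekindDomain NumberField Polynomial

set_option linter.dupNamespace false
set_option maxHeartbeats 800000

namespace Summit.Langlands.Langlands.Cruxes.IrregularClassicality.DrefuteG3.Probes

/-! ## The stub shapes as `Prop`s (verbatim from `Lines/split-ramified-prime-sqrt6.lean`,
with the μ-ordinary guard abstracted to `Q`) -/

/-- Stub 1 verbatim. -/
def Stub1 : Prop :=
    ∀ (𝔐 : Ideal (integralClosure ℤ ℂ)), 𝔐.IsMaximal → (3 : integralClosure ℤ ℂ) ∈ 𝔐 →
    ∃ ι : PadicAlgCl 3 ≃+* ℂ,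
      ∀ (z : integralClosure ℤ ℂ) (k : ℕ),
        (∃ u : integralClosure ℤ ℂ, u ∉ 𝔐 ∧ u * z ∈ Ideal.span {(3 : integralClosure ℤ ℂ) ^ k}) →
        ‖ι.symm (z : ℂ)‖ ≤ ((3 : ℝ)⁻¹) ^ k

/-- Stub 2 verbatim. -/
def Stub2 : Prop :=
    ∀ (f : ℤ[X]), f.natDegree = 4 → (f.map (Int.castRingHom ℚ)).Separable →
      12 ∣ Nat.card (f.map (Int.castRingHom ℚ)).Gal →
    ∀ (ι : PadicAlgCl 3 ≃+* ℂ) (e : CyclotomicField 3 ℚ →+* ℂ),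
    ∃ (S₀ : Finset (HeightOneSpectrum (𝓞 (CyclotomicField 3 ℚ))))
      (ϖ : HeightOneSpectrum (𝓞 (CyclotomicField 3 ℚ)) → 𝓞 (CyclotomicField 3 ℚ))
      (ρ : FramedGaloisRep (CyclotomicField 3 ℚ) (PadicAlgCl 3) 3),
      (∀ v : HeightOneSpectrum (𝓞 (CyclotomicField 3 ℚ)),
        ((3 : ℕ) : 𝓞 (CyclotomicField 3 ℚ)) ∈ v.asIdeal → v ∈ S₀) ∧
      (∀ (L : Type) [Field L] [NumberField L] [Algebra (CyclotomicField 3 ℚ) L],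
        Module.finrank (CyclotomicField 3 ℚ) L = 2 →
          FramedRep.IsAbsolutelyIrreducible (ρ.restrictField L)) ∧
      ∀ 𝔭 ∉ S₀,
        (𝔭.asIdeal = Ideal.span {ϖ 𝔭} ∧
          ϖ 𝔭 - 1 ∈ Ideal.span {(3 : 𝓞 (CyclotomicField 3 ℚ))}) ∧
        ρ.IsUnramifiedAt 𝔭 ∧
        ∀ 𝔓 ∈ 𝔭.primesAbove, ∀ τ : Field.absoluteGaloisGroup (CyclotomicField 3 ℚ),
          IsArithFrobAt (𝓞 (CyclotomicField 3 ℚ)) τ 𝔓 →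
            FramedRep.trace ρ τ⁻¹ = ι.symm (e (↑(picardTrace f 𝔭 * ϖ 𝔭)))

/-- Stub 3 with the guard abstracted to `Q f`. -/
def Stub3Q (Q : ℤ[X] → Prop) : Prop :=
    ∀ (f : ℤ[X]) (hcpt : isCompact_glFiniteIntegralLevel 3 (CyclotomicField 3 ℚ)),
      f.natDegree = 4 → (f.map (Int.castRingHom ℚ)).Separable →
      12 ∣ Nat.card (f.map (Int.castRingHom ℚ)).Gal →
      Q f →
    ∀ (e : CyclotomicField 3 ℚ →+* ℂ) (𝔐 : Ideal (integralClosure ℤ ℂ))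
      (S S₀ : Finset (HeightOneSpectrum (𝓞 (CyclotomicField 3 ℚ))))
      (ϖ : HeightOneSpectrum (𝓞 (CyclotomicField 3 ℚ)) → 𝓞 (CyclotomicField 3 ℚ)),
      𝔐.IsMaximal → (3 : integralClosure ℤ ℂ) ∈ 𝔐 →
      (∀ 𝔭 ∉ S₀, 𝔭.asIdeal = Ideal.span {ϖ 𝔭} ∧
        ϖ 𝔭 - 1 ∈ Ideal.span {(3 : 𝓞 (CyclotomicField 3 ℚ))}) →
      (∀ k : ℕ, ∃ P : CuspidalAutomorphicRepData 3 (CyclotomicField 3 ℚ) hcpt,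
        P.1.IsRegularAlgebraic ∧
        ∀ 𝔭 ∉ S, ∃ (α : Multiset ℂ) (t u : integralClosure ℤ ℂ), P.1.HasSatakeParamAt 𝔭 α ∧
          (t : ℂ) = (𝔭.residueCard : ℂ) * α.sum - e (picardTrace f 𝔭) ∧ u ∉ 𝔐 ∧
          u * t ∈ Ideal.span {(3 : integralClosure ℤ ℂ) ^ k}) →
    ∃ (c₀ : CyclotomicField 3 ℚ ≃ₐ[ℚ] CyclotomicField 3 ℚ)
      (S' : Finset (HeightOneSpectrum (𝓞 (CyclotomicField 3 ℚ)))), c₀ ≠ 1 ∧ S ⊆ S' ∧ S₀ ⊆ S' ∧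
      ∀ k : ℕ, ∃ P : CuspidalAutomorphicRepData 3 (CyclotomicField 3 ℚ) hcpt,
        P.1.IsRegularAlgebraic ∧ P.1.IsConjSelfDualAE c₀ ∧
        ∀ 𝔭 ∉ S', ∃ (α : Multiset ℂ) (t u : integralClosure ℤ ℂ), P.1.HasSatakeParamAt 𝔭 α ∧
          (t : ℂ) = (𝔭.residueCard : ℂ) * α.sum - e (↑(picardTrace f 𝔭 * ϖ 𝔭)) ∧ u ∉ 𝔐 ∧
          u * t ∈ Ideal.span {(3 : integralClosure ℤ ℂ) ^ k}

/-- Stub 4 verbatim. -/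
def Stub4 : Prop :=
    ∀ (𝔐 : Ideal (integralClosure ℤ ℂ)), 𝔐.IsMaximal → (3 : integralClosure ℤ ℂ) ∈ 𝔐 →
    ∀ (ι : PadicAlgCl 3 ≃+* ℂ),
      (∀ (z : integralClosure ℤ ℂ) (k : ℕ),
        (∃ u : integralClosure ℤ ℂ, u ∉ 𝔐 ∧ u * z ∈ Ideal.span {(3 : integralClosure ℤ ℂ) ^ k}) →
        ‖ι.symm (z : ℂ)‖ ≤ ((3 : ℝ)⁻¹) ^ k) →
    ∀ (hcpt : isCompact_glFiniteIntegralLevel 3 (CyclotomicField 3 ℚ))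
      (c₀ : CyclotomicField 3 ℚ ≃ₐ[ℚ] CyclotomicField 3 ℚ), c₀ ≠ 1 →
    ∀ (S S₀ : Finset (HeightOneSpectrum (𝓞 (CyclotomicField 3 ℚ))))
      (a : HeightOneSpectrum (𝓞 (CyclotomicField 3 ℚ)) → ℂ)
      (ρ : FramedGaloisRep (CyclotomicField 3 ℚ) (PadicAlgCl 3) 3),
      (∀ v : HeightOneSpectrum (𝓞 (CyclotomicField 3 ℚ)),
        ((3 : ℕ) : 𝓞 (CyclotomicField 3 ℚ)) ∈ v.asIdeal → v ∈ S₀) →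
      (∀ 𝔭 ∉ S₀, ρ.IsUnramifiedAt 𝔭 ∧
        ∀ 𝔓 ∈ 𝔭.primesAbove, ∀ τ : Field.absoluteGaloisGroup (CyclotomicField 3 ℚ),
          IsArithFrobAt (𝓞 (CyclotomicField 3 ℚ)) τ 𝔓 → FramedRep.trace ρ τ⁻¹ = ι.symm (a 𝔭)) →
      (∀ k : ℕ, ∃ P : CuspidalAutomorphicRepData 3 (CyclotomicField 3 ℚ) hcpt,
        P.1.IsRegularAlgebraic ∧ P.1.IsConjSelfDualAE c₀ ∧
        ∀ 𝔭 ∉ S, ∃ (α : Multiset ℂ) (t u : integralClosure ℤ ℂ), P.1.HasSatakeParamAt 𝔭 α ∧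
          (t : ℂ) = (𝔭.residueCard : ℂ) * α.sum - a 𝔭 ∧ u ∉ 𝔐 ∧
          u * t ∈ Ideal.span {(3 : integralClosure ℤ ℂ) ^ k}) →
    ∃ (L : Type) (_ : Field L) (_ : NumberField L) (_ : Algebra (CyclotomicField 3 ℚ) L)
      (s : L) (c : L ≃ₐ[ℚ] L) (hcptL : isCompact_glFiniteIntegralLevel 3 L)
      (S_L : Finset (HeightOneSpectrum (𝓞 L))),
      NumberField.IsCMField L ∧ s ^ 2 = -2 ∧ Module.finrank (CyclotomicField 3 ℚ) L = 2 ∧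
      c s = -s ∧
      (∀ x : CyclotomicField 3 ℚ,
        c (algebraMap (CyclotomicField 3 ℚ) L x) = algebraMap (CyclotomicField 3 ℚ) L (c₀ x)) ∧
      (∀ w : HeightOneSpectrum (𝓞 L), ((3 : ℕ) : 𝓞 L) ∈ w.asIdeal → w ∈ S_L) ∧
      (∀ w : HeightOneSpectrum (𝓞 L), w.under (𝓞 (CyclotomicField 3 ℚ)) ∈ S₀ → w ∈ S_L) ∧
      ∀ k : ℕ, ∃ (P : CuspidalAutomorphicRepData 3 L hcptL)
        (r : FramedGaloisRep L (PadicAlgCl 3) 3),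
        P.1.IsRegularAlgebraic ∧ P.1.IsConjSelfDualAE c ∧
        (∀ w ∉ S_L, P.1.IsUnramifiedAt w ∧ IsGaloisCompatibleAt P.1 ι r w) ∧
        ∀ g : Field.absoluteGaloisGroup L,
          ‖FramedRep.trace r g - FramedRep.trace (ρ.restrictField L) g‖ ≤ ((3 : ℝ)⁻¹) ^ k

/-- The body of Stub 5 after its guard (shared by the `f`-level and Galois-level variants). -/
def Stub5Body (f : ℤ[X]) (ι : PadicAlgCl 3 ≃+* ℂ) (e : CyclotomicField 3 ℚ →+* ℂ)
    (S₀ : Finset (HeightOneSpectrum (𝓞 (CyclotomicField 3 ℚ))))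
    (ϖ : HeightOneSpectrum (𝓞 (CyclotomicField 3 ℚ)) → 𝓞 (CyclotomicField 3 ℚ))
    (ρ : FramedGaloisRep (CyclotomicField 3 ℚ) (PadicAlgCl 3) 3) : Prop :=
      (∀ v : HeightOneSpectrum (𝓞 (CyclotomicField 3 ℚ)),
        ((3 : ℕ) : 𝓞 (CyclotomicField 3 ℚ)) ∈ v.asIdeal → v ∈ S₀) →
      (∀ 𝔭 ∉ S₀,
        (𝔭.asIdeal = Ideal.span {ϖ 𝔭} ∧
          ϖ 𝔭 - 1 ∈ Ideal.span {(3 : 𝓞 (CyclotomicField 3 ℚ))}) ∧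
        ρ.IsUnramifiedAt 𝔭 ∧
        ∀ 𝔓 ∈ 𝔭.primesAbove, ∀ τ : Field.absoluteGaloisGroup (CyclotomicField 3 ℚ),
          IsArithFrobAt (𝓞 (CyclotomicField 3 ℚ)) τ 𝔓 →
            FramedRep.trace ρ τ⁻¹ = ι.symm (e (↑(picardTrace f 𝔭 * ϖ 𝔭)))) →
    ∀ (L : Type) [Field L] [NumberField L] [Algebra (CyclotomicField 3 ℚ) L]
      (s : L) (c : L ≃ₐ[ℚ] L) (c₀ : CyclotomicField 3 ℚ ≃ₐ[ℚ] CyclotomicField 3 ℚ)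
      (hcptL : isCompact_glFiniteIntegralLevel 3 L) (S_L : Finset (HeightOneSpectrum (𝓞 L))),
      NumberField.IsCMField L → c₀ ≠ 1 → s ^ 2 = -2 → Module.finrank (CyclotomicField 3 ℚ) L = 2 →
      c s = -s →
      (∀ x : CyclotomicField 3 ℚ,
        c (algebraMap (CyclotomicField 3 ℚ) L x) = algebraMap (CyclotomicField 3 ℚ) L (c₀ x)) →
      FramedRep.IsAbsolutelyIrreducible (ρ.restrictField L) →
      (∀ w : HeightOneSpectrum (𝓞 L), ((3 : ℕ) : 𝓞 L) ∈ w.asIdeal → w ∈ S_L) →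
      (∀ w : HeightOneSpectrum (𝓞 L), w.under (𝓞 (CyclotomicField 3 ℚ)) ∈ S₀ → w ∈ S_L) →
      (∀ k : ℕ, ∃ (P : CuspidalAutomorphicRepData 3 L hcptL)
        (r : FramedGaloisRep L (PadicAlgCl 3) 3),
        P.1.IsRegularAlgebraic ∧ P.1.IsConjSelfDualAE c ∧
        (∀ w ∉ S_L, P.1.IsUnramifiedAt w ∧ IsGaloisCompatibleAt P.1 ι r w) ∧
        ∀ g : Field.absoluteGaloisGroup L,
          ‖FramedRep.trace r g - FramedRep.trace (ρ.restrictField L) g‖ ≤ ((3 : ℝ)⁻¹) ^ k) →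
    ∃ (πL : CuspidalAutomorphicRepData 3 L hcptL) (S' : Finset (HeightOneSpectrum (𝓞 L))),
      πL.1.IsLAlgebraic ∧
      ∀ w ∉ S', ∃ β : Multiset ℂ, πL.1.HasSatakeParamAt w β ∧
        (ρ.restrictField L).IsUnramifiedAt w ∧
        (ρ.restrictField L).HasFrobCharpolyAt w (arithFrobPolyOfSatake ι w.residueCard 1 β)

/-- Stub 5 with the guard abstracted to `Q f`. -/
def Stub5Q (Q : ℤ[X] → Prop) : Prop :=
    ∀ (f : ℤ[X]), f.natDegree = 4 → (f.map (Int.castRingHom ℚ)).Separable →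
      12 ∣ Nat.card (f.map (Int.castRingHom ℚ)).Gal →
      Q f →
    ∀ (ι : PadicAlgCl 3 ≃+* ℂ) (e : CyclotomicField 3 ℚ →+* ℂ)
      (S₀ : Finset (HeightOneSpectrum (𝓞 (CyclotomicField 3 ℚ))))
      (ϖ : HeightOneSpectrum (𝓞 (CyclotomicField 3 ℚ)) → 𝓞 (CyclotomicField 3 ℚ))
      (ρ : FramedGaloisRep (CyclotomicField 3 ℚ) (PadicAlgCl 3) 3),
      Stub5Body f ι e S₀ ϖ ρ

/-- Stub 6 verbatim. -/
def Stub6 : Prop :=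
    ∀ (f : ℤ[X]) (hcpt : isCompact_glFiniteIntegralLevel 3 (CyclotomicField 3 ℚ)),
      f.natDegree = 4 → (f.map (Int.castRingHom ℚ)).Separable →
      12 ∣ Nat.card (f.map (Int.castRingHom ℚ)).Gal →
    ∀ (ι : PadicAlgCl 3 ≃+* ℂ) (e : CyclotomicField 3 ℚ →+* ℂ)
      (S₀ : Finset (HeightOneSpectrum (𝓞 (CyclotomicField 3 ℚ))))
      (ϖ : HeightOneSpectrum (𝓞 (CyclotomicField 3 ℚ)) → 𝓞 (CyclotomicField 3 ℚ))
      (ρ : FramedGaloisRep (CyclotomicField 3 ℚ) (PadicAlgCl 3) 3),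
      (∀ v : HeightOneSpectrum (𝓞 (CyclotomicField 3 ℚ)),
        ((3 : ℕ) : 𝓞 (CyclotomicField 3 ℚ)) ∈ v.asIdeal → v ∈ S₀) →
      (∀ 𝔭 ∉ S₀,
        (𝔭.asIdeal = Ideal.span {ϖ 𝔭} ∧
          ϖ 𝔭 - 1 ∈ Ideal.span {(3 : 𝓞 (CyclotomicField 3 ℚ))}) ∧
        ρ.IsUnramifiedAt 𝔭 ∧
        ∀ 𝔓 ∈ 𝔭.primesAbove, ∀ τ : Field.absoluteGaloisGroup (CyclotomicField 3 ℚ),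
          IsArithFrobAt (𝓞 (CyclotomicField 3 ℚ)) τ 𝔓 →
            FramedRep.trace ρ τ⁻¹ = ι.symm (e (↑(picardTrace f 𝔭 * ϖ 𝔭)))) →
    ∀ (L : Type) [Field L] [NumberField L] [Algebra (CyclotomicField 3 ℚ) L]
      (hcptL : isCompact_glFiniteIntegralLevel 3 L),
      NumberField.IsCMField L → Module.finrank (CyclotomicField 3 ℚ) L = 2 →
      FramedRep.IsAbsolutelyIrreducible (ρ.restrictField L) →
    ∀ (πL : CuspidalAutomorphicRepData 3 L hcptL) (S' : Finset (HeightOneSpectrum (𝓞 L))),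
      πL.1.IsLAlgebraic →
      (∀ w ∉ S', ∃ β : Multiset ℂ, πL.1.HasSatakeParamAt w β ∧
        (ρ.restrictField L).IsUnramifiedAt w ∧
        (ρ.restrictField L).HasFrobCharpolyAt w (arithFrobPolyOfSatake ι w.residueCard 1 β)) →
    ∃ πK : CuspidalAutomorphicRepData 3 (CyclotomicField 3 ℚ) hcpt, πK.1.IsLAlgebraic ∧
      ∀ᶠ 𝔭 : HeightOneSpectrum (𝓞 (CyclotomicField 3 ℚ)) in Filter.cofinite, ∃ α : Multiset ℂ,
        πK.1.HasSatakeParamAt 𝔭 α ∧ α.sum = e (picardTrace f 𝔭)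

/-- The typed tower of the crux hypothesis for fixed `(e, 𝔐, S)`. -/
def Tower (f : ℤ[X]) (hcpt : isCompact_glFiniteIntegralLevel 3 (CyclotomicField 3 ℚ))
    (e : CyclotomicField 3 ℚ →+* ℂ) (𝔐 : Ideal (integralClosure ℤ ℂ))
    (S : Finset (HeightOneSpectrum (𝓞 (CyclotomicField 3 ℚ)))) : Prop :=
  ∀ k : ℕ, ∃ P : CuspidalAutomorphicRepData 3 (CyclotomicField 3 ℚ) hcpt,
    P.1.IsRegularAlgebraic ∧
    ∀ 𝔭 ∉ S, ∃ (α : Multiset ℂ) (t u : integralClosure ℤ ℂ),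
      P.1.HasSatakeParamAt 𝔭 α ∧
      (t : ℂ) = (𝔭.residueCard : ℂ) * α.sum - e (picardTrace f 𝔭) ∧
      u ∉ 𝔐 ∧ u * t ∈ Ideal.span {(3 : integralClosure ℤ ℂ) ^ k}

/-- The crux conclusion. -/
def Conclusion (f : ℤ[X]) (hcpt : isCompact_glFiniteIntegralLevel 3 (CyclotomicField 3 ℚ)) : Prop :=
  ∃ (e : CyclotomicField 3 ℚ →+* ℂ) (π : CuspidalAutomorphicRepData 3 (CyclotomicField 3 ℚ) hcpt),
    π.1.IsLAlgebraic ∧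
    ∀ᶠ 𝔭 : HeightOneSpectrum (𝓞 (CyclotomicField 3 ℚ)) in Filter.cofinite, ∃ α : Multiset ℂ,
      π.1.HasSatakeParamAt 𝔭 α ∧ α.sum = e (picardTrace f 𝔭)

/-- Stub 7 (the remainder) with the guard abstracted to `¬ Q f`. -/
def Stub7Q (Q : ℤ[X] → Prop) : Prop :=
    ∀ (f : ℤ[X]) (hcpt : isCompact_glFiniteIntegralLevel 3 (CyclotomicField 3 ℚ)),
      f.natDegree = 4 → (f.map (Int.castRingHom ℚ)).Separable →
      12 ∣ Nat.card (f.map (Int.castRingHom ℚ)).Gal →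
      ¬ Q f →
      (∃ (e : CyclotomicField 3 ℚ →+* ℂ) (𝔐 : Ideal (integralClosure ℤ ℂ))
          (S : Finset (HeightOneSpectrum (𝓞 (CyclotomicField 3 ℚ)))),
          𝔐.IsMaximal ∧ (3 : integralClosure ℤ ℂ) ∈ 𝔐 ∧ Tower f hcpt e 𝔐 S) →
      Conclusion f hcpt

/-- Sanity: the crux is literally `∀ f hcpt, admissible → (∃ e 𝔐 S, … ∧ Tower) → Conclusion`. -/
theorem crux_iff :
    Summit.Langlands.Langlands.Theses.PicardMuOrdinary.IrregularClassicality ↔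
    ∀ (f : ℤ[X]) (hcpt : isCompact_glFiniteIntegralLevel 3 (CyclotomicField 3 ℚ)),
      f.natDegree = 4 → (f.map (Int.castRingHom ℚ)).Separable →
      12 ∣ Nat.card (f.map (Int.castRingHom ℚ)).Gal →
      (∃ (e : CyclotomicField 3 ℚ →+* ℂ) (𝔐 : Ideal (integralClosure ℤ ℂ))
          (S : Finset (HeightOneSpectrum (𝓞 (CyclotomicField 3 ℚ)))),
          𝔐.IsMaximal ∧ (3 : integralClosure ℤ ℂ) ∈ 𝔐 ∧ Tower f hcpt e 𝔐 S) →
      Conclusion f hcpt :=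
  Iff.rfl

/-! ## (1) The composition is predicate-agnostic (`f`-level guard) -/

/-- **For ANY guard `Q`, the seven stub shapes imply the crux** (same proof script as the
skeleton's `IrregularClassicality_of`).  Hence the planner's predicate swap
(`HasMuOrdinaryReductionAtThree` ↦ Jacobian-level type (b)) changes only the guard of Stubs 3/5/7. -/
theorem composition_of_any_split (Q : ℤ[X] → Prop)
    (h1 : Stub1) (h2 : Stub2) (h3 : Stub3Q Q) (h4 : Stub4) (h5 : Stub5Q Q) (h6 : Stub6)
    (h7 : Stub7Q Q) :
    Summit.Langlands.Langlands.Theses.PicardMuOrdinary.IrregularClassicality := by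
  intro f hcpt hdeg hsep hgal hlim
  classical
  by_cases hmu : Q f
  swap
  · exact h7 f hcpt hdeg hsep hgal hmu hlim
  obtain ⟨e, 𝔐, S, h𝔐, h3mem, htower⟩ := hlim
  obtain ⟨ι, hι⟩ := h1 𝔐 h𝔐 h3mem
  obtain ⟨S₀, ϖ, ρ, hS₀, hirr, hρ⟩ := h2 f hdeg hsep hgal ι e
  obtain ⟨c₀, S', hc₀, -, -, hpol⟩ :=
    h3 f hcpt hdeg hsep hgal hmu e 𝔐 S S₀ ϖ h𝔐 h3mem (fun 𝔭 h𝔭 => (hρ 𝔭 h𝔭).1) htower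
  obtain ⟨L, _instF, _instNF, _instA, s, c, hcptL, S_L, hCM, hs, hdegL, hcs, hcc₀, hSL3, hSLS₀,
      htowerL⟩ :=
    h4 𝔐 h𝔐 h3mem ι hι hcpt c₀ hc₀ S' S₀
      (fun 𝔭 => e (↑(picardTrace f 𝔭 * ϖ 𝔭))) ρ hS₀ (fun 𝔭 h𝔭 => (hρ 𝔭 h𝔭).2) hpol
  obtain ⟨πL, S'', hLalg, hcompat⟩ :=
    h5 f hdeg hsep hgal hmu ι e S₀ ϖ ρ hS₀ hρ L s c c₀ hcptL S_L
      hCM hc₀ hs hdegL hcs hcc₀ (hirr L hdegL) hSL3 hSLS₀ htowerL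
  obtain ⟨πK, hKalg, hev⟩ :=
    h6 f hcpt hdeg hsep hgal ι e S₀ ϖ ρ hS₀ hρ L hcptL hCM hdegL (hirr L hdegL) πL S'' hLalg hcompat
  exact ⟨e, πK, hKalg, hev⟩

/-! ## (2) For an EMPTY guard the remainder stub IS the crux (the costume, for general `Q`) -/

/-- If `Q` fails for every admissible `f` (as `HasMuOrdinaryReductionAtThree` does on `ℤ[X]`,
BBW 2017 Lemma 4), the remainder stub is equivalent to the crux. -/
theorem remainder_iff_crux_of_empty (Q : ℤ[X] → Prop)
    (hQ : ∀ f : ℤ[X], f.natDegree = 4 → (f.map (Int.castRingHom ℚ)).Separable →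
      12 ∣ Nat.card (f.map (Int.castRingHom ℚ)).Gal → ¬ Q f) :
    Stub7Q Q ↔ Summit.Langlands.Langlands.Theses.PicardMuOrdinary.IrregularClassicality := by
  constructor
  · intro h7 f hcpt hdeg hsep hgal hlim
    exact h7 f hcpt hdeg hsep hgal (hQ f hdeg hsep hgal) hlim
  · intro hcrux f hcpt hdeg hsep hgal _ hlim
    exact hcrux f hcpt hdeg hsep hgal hlim

/-- Unconditionally the crux implies the remainder stub (for any guard). -/
theorem remainder_of_crux (Q : ℤ[X] → Prop)
    (hcrux : Summit.Langlands.Langlands.Theses.PicardMuOrdinary.IrregularClassicality) :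
    Stub7Q Q :=
  fun f hcpt hdeg hsep hgal _ hlim => hcrux f hcpt hdeg hsep hgal hlim

/-- And for an empty guard the guarded stubs are free (whatever their bodies). -/
theorem guarded_of_empty (Q : ℤ[X] → Prop) (Body : ℤ[X] → Prop)
    (hQ : ∀ f : ℤ[X], f.natDegree = 4 → (f.map (Int.castRingHom ℚ)).Separable →
      12 ∣ Nat.card (f.map (Int.castRingHom ℚ)).Gal → ¬ Q f) :
    ∀ (f : ℤ[X]), f.natDegree = 4 → (f.map (Int.castRingHom ℚ)).Separable →
      12 ∣ Nat.card (f.map (Int.castRingHom ℚ)).Gal → Q f → Body f :=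
  fun f hdeg hsep hgal hq => absurd hq (hQ f hdeg hsep hgal)

/-! ## (3) A Galois-side guard: case split AFTER Stubs 1–2, remainder with `ι, ρ` in hand -/

/-- A guard on Stub 2's output (e.g. "`ρ.toLocal λ` is potentially Borel-ordinary for
`Res_{K_λ/ℚ₃} GL₃` with graded characters of labelled Hodge–Tate weights `(1,1), (1,0), (0,0)`";
any `Prop`-valued function will do for the logic). -/
abbrev GaloisGuard : Type :=
  ℤ[X] → (PadicAlgCl 3 ≃+* ℂ) → (CyclotomicField 3 ℚ →+* ℂ) →
    FramedGaloisRep (CyclotomicField 3 ℚ) (PadicAlgCl 3) 3 → Prop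

/-- Stub 3 guarded on the Galois side (extra binders `ι ρ`, otherwise verbatim). -/
def Stub3G (Q : GaloisGuard) : Prop :=
    ∀ (f : ℤ[X]) (hcpt : isCompact_glFiniteIntegralLevel 3 (CyclotomicField 3 ℚ)),
      f.natDegree = 4 → (f.map (Int.castRingHom ℚ)).Separable →
      12 ∣ Nat.card (f.map (Int.castRingHom ℚ)).Gal →
    ∀ (ι : PadicAlgCl 3 ≃+* ℂ) (e : CyclotomicField 3 ℚ →+* ℂ)
      (ρ : FramedGaloisRep (CyclotomicField 3 ℚ) (PadicAlgCl 3) 3), Q f ι e ρ →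
    ∀ (𝔐 : Ideal (integralClosure ℤ ℂ))
      (S S₀ : Finset (HeightOneSpectrum (𝓞 (CyclotomicField 3 ℚ))))
      (ϖ : HeightOneSpectrum (𝓞 (CyclotomicField 3 ℚ)) → 𝓞 (CyclotomicField 3 ℚ)),
      𝔐.IsMaximal → (3 : integralClosure ℤ ℂ) ∈ 𝔐 →
      (∀ 𝔭 ∉ S₀, 𝔭.asIdeal = Ideal.span {ϖ 𝔭} ∧
        ϖ 𝔭 - 1 ∈ Ideal.span {(3 : 𝓞 (CyclotomicField 3 ℚ))}) →
      Tower f hcpt e 𝔐 S →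
    ∃ (c₀ : CyclotomicField 3 ℚ ≃ₐ[ℚ] CyclotomicField 3 ℚ)
      (S' : Finset (HeightOneSpectrum (𝓞 (CyclotomicField 3 ℚ)))), c₀ ≠ 1 ∧ S ⊆ S' ∧ S₀ ⊆ S' ∧
      ∀ k : ℕ, ∃ P : CuspidalAutomorphicRepData 3 (CyclotomicField 3 ℚ) hcpt,
        P.1.IsRegularAlgebraic ∧ P.1.IsConjSelfDualAE c₀ ∧
        ∀ 𝔭 ∉ S', ∃ (α : Multiset ℂ) (t u : integralClosure ℤ ℂ), P.1.HasSatakeParamAt 𝔭 α ∧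
          (t : ℂ) = (𝔭.residueCard : ℂ) * α.sum - e (↑(picardTrace f 𝔭 * ϖ 𝔭)) ∧ u ∉ 𝔐 ∧
          u * t ∈ Ideal.span {(3 : integralClosure ℤ ℂ) ^ k}

/-- Stub 5 guarded on the Galois side. -/
def Stub5G (Q : GaloisGuard) : Prop :=
    ∀ (f : ℤ[X]), f.natDegree = 4 → (f.map (Int.castRingHom ℚ)).Separable →
      12 ∣ Nat.card (f.map (Int.castRingHom ℚ)).Gal →
    ∀ (ι : PadicAlgCl 3 ≃+* ℂ) (e : CyclotomicField 3 ℚ →+* ℂ)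
      (S₀ : Finset (HeightOneSpectrum (𝓞 (CyclotomicField 3 ℚ))))
      (ϖ : HeightOneSpectrum (𝓞 (CyclotomicField 3 ℚ)) → 𝓞 (CyclotomicField 3 ℚ))
      (ρ : FramedGaloisRep (CyclotomicField 3 ℚ) (PadicAlgCl 3) 3), Q f ι e ρ →
      Stub5Body f ι e S₀ ϖ ρ

/-- The Galois-side REMAINDER: the crux on `¬ Q`, but with `ι` adapted to `𝔐`, the primary
generators, `ρ` with its trace identity and irreducibility, and the tower for THIS `(e, 𝔐, S)` all in
hand — what a finite-slope / non-ordinary engine would actually start from. -/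
def Stub7G (Q : GaloisGuard) : Prop :=
    ∀ (f : ℤ[X]) (hcpt : isCompact_glFiniteIntegralLevel 3 (CyclotomicField 3 ℚ)),
      f.natDegree = 4 → (f.map (Int.castRingHom ℚ)).Separable →
      12 ∣ Nat.card (f.map (Int.castRingHom ℚ)).Gal →
    ∀ (ι : PadicAlgCl 3 ≃+* ℂ) (e : CyclotomicField 3 ℚ →+* ℂ) (𝔐 : Ideal (integralClosure ℤ ℂ))
      (S S₀ : Finset (HeightOneSpectrum (𝓞 (CyclotomicField 3 ℚ))))
      (ϖ : HeightOneSpectrum (𝓞 (CyclotomicField 3 ℚ)) → 𝓞 (CyclotomicField 3 ℚ))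
      (ρ : FramedGaloisRep (CyclotomicField 3 ℚ) (PadicAlgCl 3) 3),
      𝔐.IsMaximal → (3 : integralClosure ℤ ℂ) ∈ 𝔐 →
      (∀ (z : integralClosure ℤ ℂ) (k : ℕ),
        (∃ u : integralClosure ℤ ℂ, u ∉ 𝔐 ∧ u * z ∈ Ideal.span {(3 : integralClosure ℤ ℂ) ^ k}) →
        ‖ι.symm (z : ℂ)‖ ≤ ((3 : ℝ)⁻¹) ^ k) →
      (∀ v : HeightOneSpectrum (𝓞 (CyclotomicField 3 ℚ)),
        ((3 : ℕ) : 𝓞 (CyclotomicField 3 ℚ)) ∈ v.asIdeal → v ∈ S₀) →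
      (∀ (L : Type) [Field L] [NumberField L] [Algebra (CyclotomicField 3 ℚ) L],
        Module.finrank (CyclotomicField 3 ℚ) L = 2 →
          FramedRep.IsAbsolutelyIrreducible (ρ.restrictField L)) →
      (∀ 𝔭 ∉ S₀,
        (𝔭.asIdeal = Ideal.span {ϖ 𝔭} ∧
          ϖ 𝔭 - 1 ∈ Ideal.span {(3 : 𝓞 (CyclotomicField 3 ℚ))}) ∧
        ρ.IsUnramifiedAt 𝔭 ∧
        ∀ 𝔓 ∈ 𝔭.primesAbove, ∀ τ : Field.absoluteGaloisGroup (CyclotomicField 3 ℚ),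
          IsArithFrobAt (𝓞 (CyclotomicField 3 ℚ)) τ 𝔓 →
            FramedRep.trace ρ τ⁻¹ = ι.symm (e (↑(picardTrace f 𝔭 * ϖ 𝔭)))) →
      ¬ Q f ι e ρ →
      Tower f hcpt e 𝔐 S →
      Conclusion f hcpt

/-- **Composition with a Galois-side guard** (kernel-checked reshape template). -/
theorem composition_of_galois_split (Q : GaloisGuard)
    (h1 : Stub1) (h2 : Stub2) (h3 : Stub3G Q) (h4 : Stub4) (h5 : Stub5G Q) (h6 : Stub6)
    (h7 : Stub7G Q) :
    Summit.Langlands.Langlands.Theses.PicardMuOrdinary.IrregularClassicality := by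
  intro f hcpt hdeg hsep hgal hlim
  classical
  obtain ⟨e, 𝔐, S, h𝔐, h3mem, htower⟩ := hlim
  obtain ⟨ι, hι⟩ := h1 𝔐 h𝔐 h3mem
  obtain ⟨S₀, ϖ, ρ, hS₀, hirr, hρ⟩ := h2 f hdeg hsep hgal ι e
  by_cases hmu : Q f ι e ρ
  swap
  · exact h7 f hcpt hdeg hsep hgal ι e 𝔐 S S₀ ϖ ρ h𝔐 h3mem hι hS₀ hirr hρ hmu htower
  obtain ⟨c₀, S', hc₀, -, -, hpol⟩ :=
    h3 f hcpt hdeg hsep hgal ι e ρ hmu 𝔐 S S₀ ϖ h𝔐 h3mem (fun 𝔭 h𝔭 => (hρ 𝔭 h𝔭).1) htower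
  obtain ⟨L, _instF, _instNF, _instA, s, c, hcptL, S_L, hCM, hs, hdegL, hcs, hcc₀, hSL3, hSLS₀,
      htowerL⟩ :=
    h4 𝔐 h𝔐 h3mem ι hι hcpt c₀ hc₀ S' S₀
      (fun 𝔭 => e (↑(picardTrace f 𝔭 * ϖ 𝔭))) ρ hS₀ (fun 𝔭 h𝔭 => (hρ 𝔭 h𝔭).2) hpol
  obtain ⟨πL, S'', hLalg, hcompat⟩ :=
    h5 f hdeg hsep hgal ι e S₀ ϖ ρ hmu hS₀ hρ L s c c₀ hcptL S_L
      hCM hc₀ hs hdegL hcs hcc₀ (hirr L hdegL) hSL3 hSLS₀ htowerL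
  obtain ⟨πK, hKalg, hev⟩ :=
    h6 f hcpt hdeg hsep hgal ι e S₀ ϖ ρ hS₀ hρ L hcptL hCM hdegL (hirr L hdegL) πL S'' hLalg hcompat
  exact ⟨e, πK, hKalg, hev⟩

/-- The typed line is the instance `Q := HasMuOrdinaryReductionAtThree` of (1). -/
example (h1 : Stub1) (h2 : Stub2)
    (h3 : Stub3Q Literature.AlgebraicGeometry.Motives.HasMuOrdinaryReductionAtThree) (h4 : Stub4)
    (h5 : Stub5Q Literature.AlgebraicGeometry.Motives.HasMuOrdinaryReductionAtThree) (h6 : Stub6)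
    (h7 : Stub7Q Literature.AlgebraicGeometry.Motives.HasMuOrdinaryReductionAtThree) :
    Summit.Langlands.Langlands.Theses.PicardMuOrdinary.IrregularClassicality :=
  composition_of_any_split _ h1 h2 h3 h4 h5 h6 h7

/-! ## (4) The Frobenius-trace hypothesis is not decoration -/

variable {K : Type} [Field K] [NumberField K]

/-- From the hypothesis shape used by Stubs 2/4/5/6 one extracts an actual group element whose
trace is the prescribed value (tree facts `primesAbove_nonempty`,
`exists_isArithFrobAt_of_mem_primesAbove_holds`). -/
theorem frobTrace_hypothesis_nonvacuous {n : ℕ} (ρ : FramedGaloisRep K (PadicAlgCl 3) n)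
    (𝔭 : HeightOneSpectrum (𝓞 K)) (x : PadicAlgCl 3)
    (h : ∀ 𝔓 ∈ 𝔭.primesAbove, ∀ τ : Field.absoluteGaloisGroup K,
      IsArithFrobAt (𝓞 K) τ 𝔓 → FramedRep.trace ρ τ⁻¹ = x) :
    ∃ τ : Field.absoluteGaloisGroup K, FramedRep.trace ρ τ⁻¹ = x := by
  obtain ⟨𝔓, h𝔓⟩ := HeightOneSpectrum.primesAbove_nonempty 𝔭
  obtain ⟨τ, hτ⟩ := HeightOneSpectrum.exists_isArithFrobAt_of_mem_primesAbove_holds (v := 𝔭) h𝔓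
  exact ⟨τ, h 𝔓 h𝔓 τ hτ⟩

/-- Hence the prescribed value is PINNED by `ρ`: the same `ρ` cannot satisfy the hypothesis for two
different values at `𝔭`.  For Stub 4 this says its free function `a` is determined by `ρ` off `S₀`
(through the injective `ι.symm`). -/
theorem frobTrace_hypothesis_pins {n : ℕ} (ρ : FramedGaloisRep K (PadicAlgCl 3) n)
    (𝔭 : HeightOneSpectrum (𝓞 K)) (x y : PadicAlgCl 3)
    (hx : ∀ 𝔓 ∈ 𝔭.primesAbove, ∀ τ : Field.absoluteGaloisGroup K,
      IsArithFrobAt (𝓞 K) τ 𝔓 → FramedRep.trace ρ τ⁻¹ = x)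
    (hy : ∀ 𝔓 ∈ 𝔭.primesAbove, ∀ τ : Field.absoluteGaloisGroup K,
      IsArithFrobAt (𝓞 K) τ 𝔓 → FramedRep.trace ρ τ⁻¹ = y) : x = y := by
  obtain ⟨𝔓, h𝔓⟩ := HeightOneSpectrum.primesAbove_nonempty 𝔭
  obtain ⟨τ, hτ⟩ := HeightOneSpectrum.exists_isArithFrobAt_of_mem_primesAbove_holds (v := 𝔭) h𝔓
  rw [← hx 𝔓 h𝔓 τ hτ, ← hy 𝔓 h𝔓 τ hτ]

/-- Stub 4's free `a` is determined by `ρ` (and `ι`) off `S₀`. -/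
theorem stub4_a_determined (ι : PadicAlgCl 3 ≃+* ℂ) {n : ℕ}
    (ρ : FramedGaloisRep K (PadicAlgCl 3) n) (S₀ : Finset (HeightOneSpectrum (𝓞 K)))
    (a a' : HeightOneSpectrum (𝓞 K) → ℂ)
    (ha : ∀ 𝔭 ∉ S₀, ∀ 𝔓 ∈ 𝔭.primesAbove, ∀ τ : Field.absoluteGaloisGroup K,
      IsArithFrobAt (𝓞 K) τ 𝔓 → FramedRep.trace ρ τ⁻¹ = ι.symm (a 𝔭))
    (ha' : ∀ 𝔭 ∉ S₀, ∀ 𝔓 ∈ 𝔭.primesAbove, ∀ τ : Field.absoluteGaloisGroup K,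
      IsArithFrobAt (𝓞 K) τ 𝔓 → FramedRep.trace ρ τ⁻¹ = ι.symm (a' 𝔭)) :
    ∀ 𝔭 ∉ S₀, a 𝔭 = a' 𝔭 := fun 𝔭 h𝔭 =>
  ι.symm.injective (frobTrace_hypothesis_pins ρ 𝔭 _ _ (ha 𝔭 h𝔭) (ha' 𝔭 h𝔭))

/-! ## (5) The `∃ hcptL` conjunct of Stub 4 is dischargeable -/

/-- `isCompact_glFiniteIntegralLevel 3 L` holds for every number field (tree theorem). -/
theorem hcptL_dischargeable (L : Type) [Field L] [NumberField L] :
    isCompact_glFiniteIntegralLevel 3 L :=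
  isCompact_glFiniteIntegralLevel_holds 3 L


/-! ## (6) Reshape r2 (lead, 04:31Z): guard removed, Stub 7 deleted, Stub 1 landed (p78785)

The r2 skeleton states Stubs 3 and 5 for EVERY generic `f` (linear chain 2 → 3 → 4 → 5 → 6).  In the
vocabulary above this is the instance `Q := fun _ => True`; and the honest re-split of r2's Stub 5 the
lead asks for ("μ-ordinary-Jacobian engine" + "conceded remainder") is, with a Galois-side guard, just
the conjunction below — the remainder `Stub5RemG Q` keeps the polarized Galois-convergent tower over `L`
in hand (it is the finite/infinite-slope classicality statement of the saddle card's domain). -/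

/-- r2's unguarded Stub 3. -/
def Stub3U : Prop := Stub3Q fun _ => True

/-- r2's unguarded Stub 5. -/
def Stub5U : Prop :=
    ∀ (f : ℤ[X]), f.natDegree = 4 → (f.map (Int.castRingHom ℚ)).Separable →
      12 ∣ Nat.card (f.map (Int.castRingHom ℚ)).Gal →
    ∀ (ι : PadicAlgCl 3 ≃+* ℂ) (e : CyclotomicField 3 ℚ →+* ℂ)
      (S₀ : Finset (HeightOneSpectrum (𝓞 (CyclotomicField 3 ℚ))))
      (ϖ : HeightOneSpectrum (𝓞 (CyclotomicField 3 ℚ)) → 𝓞 (CyclotomicField 3 ℚ))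
      (ρ : FramedGaloisRep (CyclotomicField 3 ℚ) (PadicAlgCl 3) 3),
      Stub5Body f ι e S₀ ϖ ρ

/-- The remainder of r2's Stub 5 under a Galois-side guard: Stub 5's body on `¬ Q`. -/
def Stub5RemG (Q : GaloisGuard) : Prop :=
    ∀ (f : ℤ[X]), f.natDegree = 4 → (f.map (Int.castRingHom ℚ)).Separable →
      12 ∣ Nat.card (f.map (Int.castRingHom ℚ)).Gal →
    ∀ (ι : PadicAlgCl 3 ≃+* ℂ) (e : CyclotomicField 3 ℚ →+* ℂ)
      (S₀ : Finset (HeightOneSpectrum (𝓞 (CyclotomicField 3 ℚ))))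
      (ϖ : HeightOneSpectrum (𝓞 (CyclotomicField 3 ℚ)) → 𝓞 (CyclotomicField 3 ℚ))
      (ρ : FramedGaloisRep (CyclotomicField 3 ℚ) (PadicAlgCl 3) 3), ¬ Q f ι e ρ →
      Stub5Body f ι e S₀ ϖ ρ

/-- Re-split of r2's Stub 5: engine branch + remainder give the unguarded stub back. -/
theorem stub5U_of_resplit (Q : GaloisGuard) (hG : Stub5G Q) (hR : Stub5RemG Q) : Stub5U := by
  intro f hdeg hsep hgal ι e S₀ ϖ ρ
  by_cases hq : Q f ι e ρ
  · exact hG f hdeg hsep hgal ι e S₀ ϖ ρ hq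
  · exact hR f hdeg hsep hgal ι e S₀ ϖ ρ hq

/-- r2's composition in this vocabulary (Stub 1 is now a theorem; kept as a hypothesis here). -/
theorem composition_r2 (h1 : Stub1) (h2 : Stub2) (h3 : Stub3U) (h4 : Stub4) (h5 : Stub5U)
    (h6 : Stub6) : Summit.Langlands.Langlands.Theses.PicardMuOrdinary.IrregularClassicality :=
  composition_of_any_split (fun _ => True) h1 h2 h3 h4
    (fun f hdeg hsep hgal _ => h5 f hdeg hsep hgal) h6
    (fun _ _ _ _ _ hnot _ => absurd trivial hnot)

/-- Hence the re-split line r3 := r2 with Stub 5 replaced by `Stub5G Q` + `Stub5RemG Q` concludes. -/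
theorem composition_r2_resplit (Q : GaloisGuard) (h1 : Stub1) (h2 : Stub2) (h3 : Stub3U)
    (h4 : Stub4) (h5 : Stub5G Q) (h5' : Stub5RemG Q) (h6 : Stub6) :
    Summit.Langlands.Langlands.Theses.PicardMuOrdinary.IrregularClassicality :=
  composition_r2 h1 h2 h3 h4 (stub5U_of_resplit Q h5 h5') h6

end Summit.Langlands.Langlands.Cruxes.IrregularClassicality.DrefuteG3.Probes
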